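import Literature.Barriers.CriticalPhenomena.LongRangeTrivialityOnZ3InfraredBoundHolds
import Literature.Barriers.CriticalPhenomena.LongRangeTrivialityOnZ3InputsProofs
import Literature.Barriers.CriticalPhenomena.LongRangeTrivialityOnZ3LeeYang
import Literature.Barriers.CriticalPhenomena.LongRangeTrivialityOnZ3TreeDiagram

/-!
# `panis_thm12_holds`: Panis's Theorem 1.2 (every `d ≥ 1`) is a THEOREM — discharge of the last two
# printed infrared inputs (Proposition 3.8 (IRB) for every `α`; Remark 3.9, `d ≤ 2`) by the torus route

Sibling of `Literature/Barriers/CriticalPhenomena/LongRangeTrivialityOnZ3.lean` (barrier catalogue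
D-0021, sub-problem `Ising3DConformalLimit`), which vendors Panis's Theorem 1.2 (arXiv:2309.05797 =
Ann. Probab. 54 (2026)) as the named fact `panis_thm12` (all `d ≥ 1`, `J_{x,y} = C₀|x-y|₁^{-d-α}`,
`d - 2(α∧2) > 0`). The tree reduces it (`panis_thm12_of_facts`, `…InputsProofs.lean`, following the
printed proof of Theorem 5.5, pp. 21–22, with Remark 5.4) to five printed inputs, three of which are
theorems by now: the moment-generating-function display (`panis_mgfDeviation_le_ursellFourBoxSum_holds`,
`…LeeYang.lean`), the tree diagram bound (`panis_treeDiagramBound_holds`, `…TreeDiagram.lean`) and the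
infrared bound of §3.6 for `d ≥ 3`, `α ≠ 2` (`panis_infraredBound_algebraic_holds`,
`…InfraredBoundHolds.lean`, the TORUS ROUTE: reflection positivity and Gaussian domination on the even
tori, the vanishing of the torus zero mode below `β_c`, Griffiths' comparison free ≤ torus, a discrete
Riemann-sum estimate, and the Messager–Miracle-Solé `x`-space step). This file discharges the two
remaining ones and composes:

1. `LongRangeIsing.torus_sum_sum_box_le_of_gap`, `LongRangeIsing.sum_sum_pairCorrelation_le_torusRoute_of_gap`,
   `LongRangeIsing.pairCorrelation_le_of_gap` — the torus route of `…InfraredBoundHolds.lean` run with a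
   FREE infrared exponent: for every `d ≥ 1`, every `0 < a < d` and every cube bound
   `1 - Ĵ(q) ≥ c'‖q‖_∞^a` (`‖q‖_∞ ≤ π`) one gets `⟨σ₀σ_x⟩_β ≤ C/(β|x|^{d-a})` for all `0 < β ≤ β_c`,
   `x ≠ 0` (the `x`-space step is done with `χ_{⌊n/d⌋} ≤ χ_n` and `|Λ_n|χ_n ≤ ∑_{Λ_{2n}²}S`, so that
   `d = 1` is covered);
2. **`panis_infraredBound_rp_holds`** — Proposition 3.8 (IRB), `d ≥ 3`, EVERY `α > 0` (in particular
   `α = 2`): exponent `a = 2 < d`, the cube bound `1 - Ĵ(q) ≥ c₁‖q‖²` coming from the nearest-neighbour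
   terms of `J` alone (`sq_le_one_sub_couplingFourier_algebraic`, the "observation that `1 - Ĵ(k) ≥ C|k|²`
   for all `k ∈ (-π,π]^d`" of the printed proof), and `1/β ≤ ` Griffiths' monotonicity in `β` to pass from
   `C/(β|x|^{d-2})` to the `β`-uniform `C/(β_c|x|^{d-2})`;
3. **`panis_infraredBound_algebraic_lowDim_holds`** — Remark 3.9 (`d = 2`, `α < 2`; `d = 1`, `α < 1`):
   exponent `a = α < d` ("since in both cases `|p|^{-α}` is locally integrable" — here: the Riemann sum
   `N^{-d}∑_{k≠0}W(Lθ_k)‖θ_k‖^{-a} ≤ Γ L^{a-d}` needs exactly `a < d`), cube bound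
   `exists_cube_gap_lower` (`α ≠ 2`);
4. **`panis_thm12_holds : panis_thm12`** by `panis_thm12_of_facts`.
5. **`panis_ursellFourBoxSum_le_holds : panis_ursellFourBoxSum_le`** — the intermediate named fact of
   `…Inputs.lean` (the page-22 bound `S(β,L,R) ≤ C(β⁻⁴ ∨ β⁻²)R^γ/L^{d-2(α∧2)}` on `Σ_L⁻²∑|U₄|`, every
   `d ≥ 1`) by `panis_ursellFourBoxSum_le_of_facts` (`…InputsProofs.lean`) and the same four discharged
   inputs, so that this cone fact too stops being literature debt.

No new definitions, no new named facts.

## References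

* R. Panis, arXiv:2309.05797 (2023) = Ann. Probab. 54 (2026), Theorem 1.2, §3.3 (Prop. 3.4, Prop. 3.8
  and its proof, Remark 3.9), §3.6, proof of Theorem 5.5 (pp. 21–22), Remark 5.4 [Panis2023Triviality]
  (held, read: pp. 6–7, 13–16, 21–22).
* M. Aizenman, H. Duminil-Copin, V. Sidoravicius, CMP 334 (2015), §3.3 ((3.17), (3.19))
  [AizenmanDuminilCopinSidoraviciusCMP2015].
* J. Fröhlich, B. Simon, T. Spencer, CMP 50 (1976), §3 [FrohlichSimonSpencer1976].
-/

noncomputable section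

namespace Literature.Barriers.CriticalPhenomena

open Literature.Probability.LatticeModels Literature.Probability.Percolation Filter Topology Finset
open _root_.MeasureTheory _root_.Set
open scoped symmDiff

namespace LongRangeIsing

/-! ### The torus route with a free infrared exponent `a ∈ (0,d)` -/

section TorusGeneralExponent

variable {d N : ℕ} {C₀ α : ℝ}

/-- The torus infrared bound through a cube lower bound `1 - Ĵ(q) ≥ c'‖q‖^a` with an arbitrary exponent:
for `k ≠ 0`, `Ŝ_N(k) ≤ 1/(β|J|c'‖θ_k‖^a)` (as `torus_twoPointFourier_le_rpow`, exponent free).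
[cite: Panis2023Triviality, Proposition 3.4 and proof of Proposition 3.8 ("1 - Ĵ(k) ≥ C|k|²" on the cube)] -/
theorem torus_twoPointFourier_le_rpow_of_gap (hd : 1 ≤ d) (hC₀ : 0 < C₀) (hα : 0 < α) [NeZero N]
    (hNe : Even N) (hN4 : 4 ≤ N) {β : ℝ} (hβ : 0 < β) {a c' : ℝ} (hc' : 0 < c')
    (hglob : ∀ q : Fin d → ℝ, ‖q‖ ≤ Real.pi →
      c' * ‖q‖ ^ a ≤ 1 - couplingFourier (algebraicCoupling d C₀ α) q)
    {k : TorusSite d N} (hk : k ≠ 0) :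
    ∑ z, torusExpect (torusCoupling (algebraicCoupling d C₀ α) N) β 0 (fun σ => spinAt 0 σ * spinAt z σ) *
        (torusChar k z).re ≤
      1 / (β * couplingNorm (algebraicCoupling d C₀ α) * c') * ‖centeredMomentum N k‖ ^ (-a) := by
  have hpos := couplingNorm_algebraic_pos hd hC₀ hα
  have hθ := norm_centeredMomentum_pos hk
  have hlow := hglob _ (norm_centeredMomentum_le k)
  have hD : 0 < c' * ‖centeredMomentum N k‖ ^ a := mul_pos hc' (Real.rpow_pos_of_pos hθ _)
  have hgap : 0 < 1 - couplingFourier (algebraicCoupling d C₀ α) (centeredMomentum N k) := hD.trans_le hlow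
  refine (torus_twoPointFourier_le hd hC₀ hα hNe hN4 hβ hgap).trans ?_
  rw [Real.rpow_neg hθ.le]
  calc 1 / (β * (couplingNorm (algebraicCoupling d C₀ α) * (1 - couplingFourier (algebraicCoupling d C₀ α) (centeredMomentum N k))))
      ≤ 1 / (β * (couplingNorm (algebraicCoupling d C₀ α) * (c' * ‖centeredMomentum N k‖ ^ a))) := by
        gcongr
    _ = 1 / (β * couplingNorm (algebraicCoupling d C₀ α) * c') * (‖centeredMomentum N k‖ ^ a)⁻¹ := by
        field_simp

variable {L : ℕ}

/-- **The double sum of the torus two-point function over `Λ_L × Λ_L`, free exponent**: for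
`J_{x,y} = C₀|x-y|₁^{-d-α}` (`d ≥ 1`, `C₀, α > 0`), an exponent `0 < a < d`, a cube gap bound
`1 - Ĵ(q) ≥ c'‖q‖^a`, `N` even with `N ≥ 14L ≥ 14`, `β > 0`, `G_N(z) = ⟨σ₀σ_z⟩_{𝕋_N,J^{(N)},β}`:
`∑_{x,y∈Λ_L}G_N(x̄-ȳ) ≤ N^{-d}(∑_zG_N(z))(2L+1)^{2d} + (9π²)^dΓ^d/(|J|c') · L^{d+a}/β`,
`Γ = 394 + 2/(1-a/d)` (Parseval, the torus infrared bound off the zero mode, the Fejér envelope and the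
Riemann-sum bound — verbatim the argument of `torus_sum_sum_box_le`, which is the case `a = α∧2`, `d ≥ 3`).
[cite: Panis2023Triviality, proof of Proposition 3.8 (χ̃_L ≤ C₃L^d∫e^{-L²‖p‖²}Ŝ(p)dp; "∫W|u|^{-a}du < ∞"), torus version] -/
theorem torus_sum_sum_box_le_of_gap (hd : 1 ≤ d) (hC₀ : 0 < C₀) (hα : 0 < α) {a c' : ℝ} (ha0 : 0 < a)
    (had : a < d) (hc' : 0 < c')
    (hglob : ∀ q : Fin d → ℝ, ‖q‖ ≤ Real.pi →
      c' * ‖q‖ ^ a ≤ 1 - couplingFourier (algebraicCoupling d C₀ α) q)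
    [NeZero N] (hNe : Even N) (hL : 1 ≤ L) (hNL : 14 * L ≤ N) {β : ℝ} (hβ : 0 < β) :
    ∑ x ∈ box d L, ∑ y ∈ box d L, torusExpect (torusCoupling (algebraicCoupling d C₀ α) N) β 0
        (fun σ => spinAt 0 σ * spinAt (Torus.proj N x - Torus.proj N y) σ) ≤
      ((N : ℝ) ^ d)⁻¹ * (∑ z, torusExpect (torusCoupling (algebraicCoupling d C₀ α) N) β 0
          (fun σ => spinAt 0 σ * spinAt z σ)) * ((((2 * L + 1 : ℕ) : ℝ) ^ d) ^ 2) +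
        (9 * Real.pi ^ 2) ^ d * (394 + 2 / (1 - a / d)) ^ d /
          (couplingNorm (algebraicCoupling d C₀ α) * c') * (L : ℝ) ^ ((d : ℝ) + a) / β := by
  have hN4 : 4 ≤ N := by omega
  set J := algebraicCoupling d C₀ α with hJ
  have hpos := couplingNorm_algebraic_pos hd hC₀ hα
  have hL0 : (0 : ℝ) < L := by exact_mod_cast hL
  set G : TorusSite d N → ℝ := fun z => torusExpect (torusCoupling J N) β 0 (fun σ => spinAt 0 σ * spinAt z σ) with hG
  set θ : TorusSite d N → Fin d → ℝ := centeredMomentum N with hθ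
  set B : TorusSite d N → ℝ := fun k => ‖∑ x ∈ box d L, Complex.exp (Complex.I * (phase (θ k) x : ℂ))‖ ^ 2 with hB
  set S : TorusSite d N → ℝ := fun k => ∑ z, G z * (torusChar k z).re with hS
  -- Parseval
  have hpar : ∑ x ∈ box d L, ∑ y ∈ box d L, G (Torus.proj N x - Torus.proj N y) =
      ((N : ℝ) ^ d)⁻¹ * ∑ k, S k * B k := sum_sum_box_kernel_eq_fourier G L
  -- the zero mode
  have h0 : S 0 * B 0 = (∑ z, G z) * ((((2 * L + 1 : ℕ) : ℝ) ^ d) ^ 2) := by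
    simp only [hS, hB, hθ, torusChar_zero_left, Complex.one_re, mul_one, centeredMomentum_zero]
    rw [norm_sum_box_cexp_zero_sq]
  -- the nonzero momenta
  set U : ℝ := 1 / (β * couplingNorm J * c') with hU
  have hU0 : 0 ≤ U := by positivity
  have hk : ∀ k ∈ Finset.univ.erase (0 : TorusSite d N),
      S k * B k ≤ U * ((9 * Real.pi ^ 2) ^ d * (L : ℝ) ^ (2 * d)) * (envelope d ((L : ℝ) • θ k) * ‖θ k‖ ^ (-a)) := by
    intro k hk
    have hk0 : k ≠ 0 := Finset.ne_of_mem_erase hk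
    have hSk : S k ≤ U * ‖θ k‖ ^ (-a) := torus_twoPointFourier_le_rpow_of_gap hd hC₀ hα hNe hN4 hβ hc' hglob hk0
    have hBk : B k ≤ (9 * Real.pi ^ 2) ^ d * (L : ℝ) ^ (2 * d) * envelope d ((L : ℝ) • θ k) :=
      norm_sum_box_cexp_sq_le hL (norm_centeredMomentum_le k)
    have hB0 : 0 ≤ B k := sq_nonneg _
    have hbound0 : 0 ≤ U * ‖θ k‖ ^ (-a) := mul_nonneg hU0 (Real.rpow_nonneg (norm_nonneg _) _)
    calc S k * B k ≤ (U * ‖θ k‖ ^ (-a)) * B k := mul_le_mul_of_nonneg_right hSk hB0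
      _ ≤ (U * ‖θ k‖ ^ (-a)) * ((9 * Real.pi ^ 2) ^ d * (L : ℝ) ^ (2 * d) * envelope d ((L : ℝ) • θ k)) :=
          mul_le_mul_of_nonneg_left hBk hbound0
      _ = U * ((9 * Real.pi ^ 2) ^ d * (L : ℝ) ^ (2 * d)) * (envelope d ((L : ℝ) • θ k) * ‖θ k‖ ^ (-a)) := by ring
  have hR := riemannSum_le hd ha0 had hL hNL
  have had' : 0 < 1 - a / d := by
    have hd0 : (0 : ℝ) < d := by exact_mod_cast hd
    have : a / d < 1 := by rw [div_lt_one hd0]; exact had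
    linarith
  -- assemble
  rw [hpar, ← Finset.add_sum_erase _ _ (Finset.mem_univ (0 : TorusSite d N)), mul_add, h0]
  refine add_le_add (le_of_eq (by ring)) ?_
  calc ((N : ℝ) ^ d)⁻¹ * ∑ k ∈ Finset.univ.erase (0 : TorusSite d N), S k * B k
      ≤ ((N : ℝ) ^ d)⁻¹ * ∑ k ∈ Finset.univ.erase (0 : TorusSite d N),
          U * ((9 * Real.pi ^ 2) ^ d * (L : ℝ) ^ (2 * d)) * (envelope d ((L : ℝ) • θ k) * ‖θ k‖ ^ (-a)) :=
        mul_le_mul_of_nonneg_left (Finset.sum_le_sum hk) (by positivity)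
    _ = U * ((9 * Real.pi ^ 2) ^ d * (L : ℝ) ^ (2 * d)) *
          (((N : ℝ) ^ d)⁻¹ * ∑ k ∈ Finset.univ.erase (0 : TorusSite d N), envelope d ((L : ℝ) • θ k) * ‖θ k‖ ^ (-a)) := by
        rw [← Finset.mul_sum]; ring
    _ ≤ U * ((9 * Real.pi ^ 2) ^ d * (L : ℝ) ^ (2 * d)) * ((394 + 2 / (1 - a / d)) ^ d * (L : ℝ) ^ (a - d)) :=
        mul_le_mul_of_nonneg_left hR (by positivity)
    _ = (9 * Real.pi ^ 2) ^ d * (394 + 2 / (1 - a / d)) ^ d / (couplingNorm J * c') * (L : ℝ) ^ ((d : ℝ) + a) / β := by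
        have e : (L : ℝ) ^ (2 * d) * (L : ℝ) ^ (a - d) = (L : ℝ) ^ ((d : ℝ) + a) := by
          rw [← Real.rpow_natCast, ← Real.rpow_add hL0]
          congr 1
          push_cast
          ring
        rw [hU]
        field_simp
        rw [← e]
        ring

end TorusGeneralExponent

/-! ### Passage to `ℤ^d` below `β_c`, free exponent -/

section InfiniteVolumeGeneralExponent

variable {d : ℕ} {C₀ α : ℝ}

/-- **The double sum of the free two-point function below `β_c`, free exponent**: for
`J_{x,y} = C₀|x-y|₁^{-d-α}` (`d ≥ 1`, `C₀, α > 0`), `0 < a < d` and a cube bound `1 - Ĵ(q) ≥ c'‖q‖^a`,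
there is `K` with `∑_{x,y∈Λ_L} S_β(x-y) ≤ K L^{d+a}/β` for all `0 < β < β_c`, `L ≥ 1`: on the even tori
the zero mode is `o(N^d)` (`m*(β) = 0` below `β_c`, `torus_zeroMode_le_eventually`), the rest is
`torus_sum_sum_box_le_of_gap`, and the free state is dominated by the torus states
(`sum_sum_pairCorrelation_le_of_torus`). The case `a = α∧2`, `d ≥ 3` is `sum_sum_pairCorrelation_le_torusRoute`.
[cite: Panis2023Triviality, proof of Proposition 3.8] [cite: AizenmanDuminilCopinSidoraviciusCMP2015, §3.3 eqs. (3.17), (3.19)] -/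
theorem sum_sum_pairCorrelation_le_torusRoute_of_gap (hd : 1 ≤ d) (hC₀ : 0 < C₀) (hα : 0 < α) {a c' : ℝ}
    (ha0 : 0 < a) (had : a < d) (hc' : 0 < c')
    (hglob : ∀ q : Fin d → ℝ, ‖q‖ ≤ Real.pi →
      c' * ‖q‖ ^ a ≤ 1 - couplingFourier (algebraicCoupling d C₀ α) q) :
    ∃ K : ℝ, 0 < K ∧ ∀ (β : ℝ), 0 < β → β < LongRangeIsing.criticalBeta (algebraicCoupling d C₀ α) →
      ∀ (L : ℕ), 1 ≤ L →
        ∑ x ∈ box d L, ∑ y ∈ box d L, pairCorrelation (algebraicCoupling d C₀ α) β 0 (x - y) ≤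
          K * (L : ℝ) ^ ((d : ℝ) + a) / β := by
  set J := algebraicCoupling d C₀ α with hJ
  have hJt : ∀ a x y, J (x + a) (y + a) = J x y := algebraicCoupling_add C₀ α
  have hJnn : ∀ x y, 0 ≤ J x y := algebraicCoupling_nonneg hC₀.le α
  have hJs := algebraicCoupling_zero_summable hd hC₀.le hα
  have hpos := couplingNorm_algebraic_pos hd hC₀ hα
  set K : ℝ := (9 * Real.pi ^ 2) ^ d * (394 + 2 / (1 - a / d)) ^ d / (couplingNorm J * c') with hK
  have had' : 0 < 1 - a / d := by
    have hd0 : (0 : ℝ) < d := by exact_mod_cast hd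
    have : a / d < 1 := by rw [div_lt_one hd0]; exact had
    linarith
  have hK0 : 0 < K := by positivity
  refine ⟨K, hK0, fun β hβ hβc L hL => ?_⟩
  have hm : magnetization J β = 0 := magnetization_eq_zero_of_lt_criticalBeta J β hβ hβc hJnn
  have hL0 : (0 : ℝ) < L := by exact_mod_cast hL
  refine le_of_forall_pos_le_add fun ε hε => ?_
  -- the zero mode is eventually `≤ ε'N^d`, `ε' = ε/(2L+1)^{2d}`
  set V : ℝ := (((2 * L + 1 : ℕ) : ℝ) ^ d) ^ 2 with hV
  have hV0 : 0 < V := by positivity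
  obtain ⟨N₀, hN₀⟩ := torus_zeroMode_le_eventually J β hd hβ hJnn hJt hJs hm (show 0 < ε / V by positivity)
  refine sum_sum_pairCorrelation_le_of_torus J β hβ.le hJnn hJt hJs (N₀ := max N₀ (14 * L)) fun M _ hM hMe => ?_
  have hM14 : 14 * L ≤ M := le_of_max_le_right hM
  have hMd : (0 : ℝ) < (M : ℝ) ^ d := by
    have : (0 : ℝ) < M := by exact_mod_cast (show 0 < M by omega)
    positivity
  have hzero := hN₀ M (le_of_max_le_left hM)
  have hmain := torus_sum_sum_box_le_of_gap hd hC₀ hα ha0 had hc' hglob hMe hL hM14 hβ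
  refine hmain.trans ?_
  rw [add_comm]
  refine add_le_add le_rfl ?_
  calc ((M : ℝ) ^ d)⁻¹ * (∑ z, torusExpect (torusCoupling J M) β 0 (fun σ => spinAt 0 σ * spinAt z σ)) * V
      ≤ ((M : ℝ) ^ d)⁻¹ * (ε / V * (M : ℝ) ^ d) * V :=
        mul_le_mul_of_nonneg_right (mul_le_mul_of_nonneg_left hzero (by positivity)) hV0.le
    _ = ε := by field_simp

/-- `n^d ≤ (2n+1)^d = |Λ_n|`. [folklore] -/
theorem pow_le_card_box_self (d n : ℕ) : (n : ℝ) ^ d ≤ #(box d n) := by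
  rw [card_box]
  push_cast
  exact pow_le_pow_left₀ (Nat.cast_nonneg n) (by linarith [(Nat.cast_nonneg n : (0 : ℝ) ≤ n)]) d

/-- **The `x`-space infrared bound from a cube gap bound, every `d ≥ 1`**: for
`J_{x,y} = C₀|x-y|₁^{-d-α}` (`C₀, α > 0`), `0 < a < d` and `1 - Ĵ(q) ≥ c'‖q‖^a` on the cube, there is
`C` with `⟨σ₀σ_x⟩_β ≤ C/(β|x|^{d-a})` for all `0 < β ≤ β_c`, `x ≠ 0` (`|x| = ‖x‖_∞`). Proof (the
`x`-space step of the printed proof of Proposition 3.8): with `n = |x|`, MMS2 averaged over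
`Λ_{⌊n/d⌋}` (`card_box_mul_pairCorrelation_le_boxSusceptibility`, the tree's theorem
`panis_mms_two_point_monotone_holds`), `χ_{⌊n/d⌋} ≤ χ_n` and `|Λ_n|χ_n ≤ ∑_{Λ_{2n}×Λ_{2n}}S(u-v)` give
`n^d(n/d)^dS_β(x) ≤ K(2n)^{d+a}/β` for `β < β_c` (`sum_sum_pairCorrelation_le_torusRoute_of_gap`);
`β = β_c` by left-continuity (`tendsto_pairCorrelation_nhdsLT`).
[cite: Panis2023Triviality, proof of Proposition 3.8 (MMS2 step) and Remark 3.9] -/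
theorem pairCorrelation_le_of_gap (hd : 1 ≤ d) (hC₀ : 0 < C₀) (hα : 0 < α) {a c' : ℝ}
    (ha0 : 0 < a) (had : a < d) (hc' : 0 < c')
    (hglob : ∀ q : Fin d → ℝ, ‖q‖ ≤ Real.pi →
      c' * ‖q‖ ^ a ≤ 1 - couplingFourier (algebraicCoupling d C₀ α) q) :
    ∃ C : ℝ, 0 < C ∧ ∀ (β : ℝ), 0 < β → β ≤ LongRangeIsing.criticalBeta (algebraicCoupling d C₀ α) →
      ∀ (x : Site d), x ≠ 0 →
        pairCorrelation (algebraicCoupling d C₀ α) β 0 x ≤ C / (β * ‖x‖ ^ ((d : ℝ) - a)) := by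
  set J := algebraicCoupling d C₀ α with hJdef
  have hJnn : ∀ x y, 0 ≤ J x y := algebraicCoupling_nonneg hC₀.le α
  obtain ⟨K, hK, hsum⟩ := sum_sum_pairCorrelation_le_torusRoute_of_gap hd hC₀ hα ha0 had hc' hglob
  set C : ℝ := K * (2 : ℝ) ^ ((d : ℝ) + a) * (d : ℝ) ^ d with hCdef
  have hC : 0 < C := by positivity
  refine ⟨C, hC, fun β hβ hββc x hx => ?_⟩
  set n : ℕ := Site.supNorm x with hndef
  have hxn : ‖x‖ = n := Site.norm_eq_supNorm x
  have hn1 : 1 ≤ n := Nat.one_le_iff_ne_zero.2 fun h => hx (Site.supNorm_eq_zero_iff.1 h)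
  have hn0 : (0 : ℝ) < n := by exact_mod_cast hn1
  have hd0 : (0 : ℝ) < d := by exact_mod_cast hd
  rw [hxn]
  -- the bound below `β_c`
  have hsub : ∀ β', 0 < β' → β' < LongRangeIsing.criticalBeta J →
      pairCorrelation J β' 0 x ≤ C / (β' * (n : ℝ) ^ ((d : ℝ) - a)) := by
    intro β' hβ' hβ'c
    have hmms : ∀ u v : Site d, (d : ℝ) * ‖u‖ ≤ ‖v‖ → pairCorrelation J β' 0 v ≤ pairCorrelation J β' 0 u :=
      panis_mms_two_point_monotone_holds d hd C₀ α hC₀ hα β' hβ'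
    have h1 : (#(box d (n / d)) : ℝ) * pairCorrelation J β' 0 x ≤ boxSusceptibility J β' (n / d) :=
      card_box_mul_pairCorrelation_le_boxSusceptibility J β' hmms (by rw [hndef]; exact Nat.mul_div_le _ d)
    have h2 : boxSusceptibility J β' (n / d) ≤ boxSusceptibility J β' n :=
      boxSusceptibility_mono J β' hβ'.le hJnn (Nat.div_le_self n d)
    have h3 : (#(box d n) : ℝ) * boxSusceptibility J β' n ≤
        ∑ u ∈ box d (2 * n), ∑ v ∈ box d (2 * n), pairCorrelation J β' 0 (u - v) :=
      card_box_mul_boxSusceptibility_le_sum_sum J β' hβ'.le hJnn le_rfl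
    have h4 := hsum β' hβ' hβ'c (2 * n) (by omega)
    have hc1 : ((n : ℝ)) ^ d ≤ #(box d n) := pow_le_card_box_self d n
    have hc2 : ((n : ℝ) / d) ^ d ≤ #(box d (n / d)) := div_pow_le_card_box_div hd n
    have hcpos1 : (0 : ℝ) < #(box d n) := lt_of_lt_of_le (by positivity) hc1
    have hS := pairCorrelation_nonneg J β' hβ'.le hJnn 0 x
    have h6 : (#(box d n) : ℝ) * ((#(box d (n / d)) : ℝ) * pairCorrelation J β' 0 x) ≤
        K * (((2 * n : ℕ) : ℝ)) ^ ((d : ℝ) + a) / β' :=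
      (mul_le_mul_of_nonneg_left (h1.trans h2) hcpos1.le).trans (h3.trans h4)
    have h7 : (n : ℝ) ^ d * (((n : ℝ) / d) ^ d * pairCorrelation J β' 0 x) ≤
        K * (((2 * n : ℕ) : ℝ)) ^ ((d : ℝ) + a) / β' := by
      refine le_trans ?_ h6
      exact mul_le_mul hc1 (mul_le_mul_of_nonneg_right hc2 hS) (by positivity) hcpos1.le
    have e0 : (((2 * n : ℕ) : ℝ)) ^ ((d : ℝ) + a) = (2 : ℝ) ^ ((d : ℝ) + a) * ((n : ℝ) ^ d * (n : ℝ) ^ a) := by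
      push_cast
      rw [Real.mul_rpow (by norm_num) hn0.le, Real.rpow_add hn0, Real.rpow_natCast]
    rw [e0] at h7
    have hnd : (0 : ℝ) < (n : ℝ) ^ d * ((n : ℝ) / d) ^ d := by positivity
    rw [← mul_assoc] at h7
    have h8 : pairCorrelation J β' 0 x ≤
        K * ((2 : ℝ) ^ ((d : ℝ) + a) * ((n : ℝ) ^ d * (n : ℝ) ^ a)) / β' / ((n : ℝ) ^ d * ((n : ℝ) / d) ^ d) :=
      (le_div_iff₀' hnd).2 h7
    refine h8.trans (le_of_eq ?_)
    have e2 : (n : ℝ) ^ ((d : ℝ) - a) * (n : ℝ) ^ a = (n : ℝ) ^ d := by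
      rw [← Real.rpow_add hn0, sub_add_cancel, Real.rpow_natCast]
    have hna : (n : ℝ) ^ a ≠ 0 := (Real.rpow_pos_of_pos hn0 _).ne'
    have hnda : (n : ℝ) ^ ((d : ℝ) - a) ≠ 0 := (Real.rpow_pos_of_pos hn0 _).ne'
    have h2a : (2 : ℝ) ^ ((d : ℝ) + a) ≠ 0 := (Real.rpow_pos_of_pos two_pos _).ne'
    rw [hCdef, div_pow, ← e2]
    field_simp
  -- `β < β_c` or `β = β_c` (left-continuity)
  rcases hββc.lt_or_eq with hlt | heq
  · exact hsub β hβ hlt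
  · have hβc : 0 < LongRangeIsing.criticalBeta J := hβ.trans_le hββc
    rw [heq]
    have hlim := tendsto_pairCorrelation_nhdsLT J hJnn hβc (0 : Site d) x
    have hR : Tendsto (fun β' : ℝ => C / (β' * (n : ℝ) ^ ((d : ℝ) - a))) (𝓝[<] LongRangeIsing.criticalBeta J)
        (𝓝 (C / (LongRangeIsing.criticalBeta J * (n : ℝ) ^ ((d : ℝ) - a)))) := by
      refine (ContinuousAt.tendsto ?_).mono_left nhdsWithin_le_nhds
      refine continuousAt_const.div (continuousAt_id.mul continuousAt_const) ?_
      exact mul_ne_zero hβc.ne' (Real.rpow_pos_of_pos hn0 _).ne'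
    refine le_of_tendsto_of_tendsto hlim hR ?_
    filter_upwards [Ioo_mem_nhdsLT hβc] with β' hβ'
    exact hsub β' hβ'.1 hβ'.2

end InfiniteVolumeGeneralExponent

end LongRangeIsing

open LongRangeIsing

/-! ### The two remaining printed infrared inputs of `panis_thm12_of_facts` are theorems -/

/-- **DISCHARGE of `panis_infraredBound_rp` — Proposition 3.8 (IRB) of Panis 2023 for
`J_{x,y} = C₀|x-y|₁^{-d-α}`, `d ≥ 3`, EVERY `α > 0`, `0 < β ≤ β_c`: `⟨σ₀σ_x⟩_β ≤ C/|x|^{d-2}`.**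
Proof: the torus route with exponent `a = 2 < d` and the nearest-neighbour cube bound
`1 - Ĵ(q) ≥ c₁‖q‖²` (`sq_le_one_sub_couplingFourier_algebraic` — "the observation that
`1 - Ĵ(k) ≥ C|k|²` for all `k ∈ (-π,π]^d`" of the printed proof) gives `C/(β|x|^{d-2})`
(`pairCorrelation_le_of_gap`); then `S_β(x) ≤ S_{β_c}(x)` (Griffiths, "monotonicity in `β` of `S_β(x)`")
makes the constant `C/β_c`. If `β_c = 0` the range of `β` is empty.
[cite: Panis2023Triviality, Proposition 3.8, display (IRB), and its proof] -/
theorem panis_infraredBound_rp_holds : panis_infraredBound_rp := by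
  intro d hd C₀ α hC₀ hα
  have hd1 : 1 ≤ d := by omega
  obtain ⟨c₁, hc₁, hnn⟩ := sq_le_one_sub_couplingFourier_algebraic hd1 hC₀ hα
  have hglob : ∀ q : Fin d → ℝ, ‖q‖ ≤ Real.pi →
      c₁ * ‖q‖ ^ (2 : ℝ) ≤ 1 - couplingFourier (algebraicCoupling d C₀ α) q :=
    fun q hq => by rw [Real.rpow_two]; exact hnn q hq
  have h2d : (2 : ℝ) < d := by exact_mod_cast (show 2 < d by omega)
  obtain ⟨C, hC, hb⟩ := pairCorrelation_le_of_gap hd1 hC₀ hα two_pos h2d hc₁ hglob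
  by_cases hβc : 0 < LongRangeIsing.criticalBeta (algebraicCoupling d C₀ α)
  · refine ⟨C / LongRangeIsing.criticalBeta (algebraicCoupling d C₀ α), div_pos hC hβc,
      fun β hβ hββc x hx => ?_⟩
    calc pairCorrelation (algebraicCoupling d C₀ α) β 0 x
        ≤ pairCorrelation (algebraicCoupling d C₀ α) (LongRangeIsing.criticalBeta (algebraicCoupling d C₀ α)) 0 x :=
          pairCorrelation_mono_beta (algebraicCoupling d C₀ α) hβ.le hββc (algebraicCoupling_nonneg hC₀.le α) 0 x
      _ ≤ C / (LongRangeIsing.criticalBeta (algebraicCoupling d C₀ α) * ‖x‖ ^ ((d : ℝ) - 2)) :=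
          hb _ hβc le_rfl x hx
      _ = C / LongRangeIsing.criticalBeta (algebraicCoupling d C₀ α) / ‖x‖ ^ ((d : ℝ) - 2) := by
          rw [div_div]
  · exact ⟨1, one_pos, fun β hβ hββc x hx => absurd (hβ.trans_le hββc) hβc⟩

/-- **DISCHARGE of `panis_infraredBound_algebraic_lowDim` — the infrared bound in `d ≤ 2` (Panis 2023,
§3.3 with Remark 3.9): for `J_{x,y} = C₀|x-y|₁^{-d-α}` with `d = 2`, `α < 2` or `d = 1`, `α < 1`,
`⟨σ₀σ_x⟩_β ≤ C/(β|x|^{d-α})` for all `0 < β ≤ β_c`, `x ≠ 0`.** Proof: the torus route with exponent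
`a = α < d` ("since in both cases `|p|^{-α}` is locally integrable": the Riemann-sum bound `riemannSum_le`
needs exactly `a < d`) and the cube bound `1 - Ĵ(q) ≥ c'‖q‖^{α}` (`exists_cube_gap_lower`, `α ≠ 2`).
[cite: Panis2023Triviality, §3.3, first display of p. 16 (case α ∈ (0,2)) and Remark 3.9] -/
theorem panis_infraredBound_algebraic_lowDim_holds : panis_infraredBound_algebraic_lowDim := by
  intro d α hcase C₀ hC₀ hα
  have hd1 : 1 ≤ d := by rcases hcase with ⟨rfl, -⟩ | ⟨rfl, -⟩ <;> omega
  have hα2 : α < 2 := by rcases hcase with ⟨-, h⟩ | ⟨-, h⟩ <;> linarith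
  have had : α < d := by
    rcases hcase with ⟨rfl, h⟩ | ⟨rfl, h⟩ <;> push_cast <;> linarith
  obtain ⟨c', hc', hglob⟩ := exists_cube_gap_lower hd1 hC₀ hα hα2.ne
  rw [min_eq_left hα2.le] at hglob
  exact pairCorrelation_le_of_gap hd1 hC₀ hα hα had hc' hglob

/-! ### Theorem 1.2 -/

/-- **DISCHARGE of `panis_thm12` — Panis 2023, Theorem 1.2, every `d ≥ 1`** (`J_{x,y} = C₀|x-y|₁^{-d-α}`,
`d - 2(α∧2) > 0`, `0 < β ≤ β_c`: the Gaussian bound on the moment generating function of `T_{f,L,β}`):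
`panis_thm12_of_facts` (the printed proof of Theorem 5.5 with Remark 5.4) fed with the five discharged
printed inputs — the moment-generating-function display (`panis_mgfDeviation_le_ursellFourBoxSum_holds`),
the tree diagram bound (`panis_treeDiagramBound_holds`), the §3.6 infrared bound
(`panis_infraredBound_algebraic_holds`), Proposition 3.8 (IRB) (`panis_infraredBound_rp_holds`) and
Remark 3.9 (`panis_infraredBound_algebraic_lowDim_holds`).
[cite: Panis2023Triviality, Theorem 1.2 (proof: Theorem 5.5, pp. 21–22, with Remark 5.4)] -/
theorem panis_thm12_holds : panis_thm12 :=
  panis_thm12_of_facts panis_mgfDeviation_le_ursellFourBoxSum_holds panis_treeDiagramBound_holds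
    panis_infraredBound_algebraic_holds panis_infraredBound_rp_holds
    panis_infraredBound_algebraic_lowDim_holds

/-! ### The page-22 bound on `S(β,L,f)` -/

/-- **DISCHARGE of `panis_ursellFourBoxSum_le`** — Panis 2023, proof of Theorem 5.5, p. 22, in the
setting of Theorem 1.2: for `J_{x,y} = C₀|x-y|₁^{-d-α}`, `d ≥ 1`, `d - 2(α∧2) > 0`, there are `C, γ > 0`
with `Σ_L(β)⁻² ∑_{Λ_{RL}⁴}|U₄^β| ≤ C(β⁻⁴ ∨ β⁻²)R^γ/L^{d-2(α∧2)}` for all `0 < β ≤ β_c`, `L, R ≥ 1`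
("`S(β,L,f)/2 ≤ (1) + (2)`", "(1) `≤ C₄β⁻⁴r_f^{8+d}L^{-(d+2η-4)}`", "(2) `≤ C₉β⁻²r_f^{8+d-2η}L^{-(d+2η-4)}`",
`d + 2η - 4 = d - 2(α∧2)` for `η = 2 - α∧2`, Remarks 5.3–5.4) — by `panis_ursellFourBoxSum_le_of_facts`
fed with the discharged tree diagram bound and the three discharged infrared bounds.
[cite: Panis2023Triviality, proof of Theorem 5.5, bounds on (1) and (2) (p. 22), with Remarks 5.3–5.4 and Theorem 1.2] -/
theorem panis_ursellFourBoxSum_le_holds : panis_ursellFourBoxSum_le :=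
  panis_ursellFourBoxSum_le_of_facts panis_treeDiagramBound_holds panis_infraredBound_algebraic_holds
    panis_infraredBound_rp_holds panis_infraredBound_algebraic_lowDim_holds

end Literature.Barriers.CriticalPhenomena

end
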